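import Literature.Probability.RandomPlanarGeometry.SAWTriangularPolygonMadrasBootstrap
import HarnessLib

/-!
# Madras' `θ ≥ 1/2` bound for triangular-lattice polygons: the join-map specification and the assembly

Topic `Literature/Probability/RandomPlanarGeometry` (lane «pcv-sawmu», LINE «TRI-MADRAS»; continues
`SAWTriangularPolygonMadrasBootstrap.lean` (TREE): `triPolygonNumber_le_rpow_of_joinIneq` — any join inequality
`c·√N·q_N(𝕋)² ≤ q_{2N+K}(𝕋)` for `N ≥ N₀` gives `q_N(𝕋) ≤ A·N^{−1/2}·μ(𝕋)^N`).

Source.  N. Madras, *A rigorous bound on the critical exponent for the number of lattice trees, animals, and polygons*,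
J. Stat. Phys. 78 (1995) 681–699 [Madras1995LatticeAnimalsExponent], §2: in two dimensions `p_n ≤ A n^{−1/2} μ^n`, by an
INJECTIVE join of pairs of polygons at `Ω(n^{1/2})` relative heights (as recalled by A. Hammond, arXiv:1504.05286
[Hammond2015SAPJoining], §2 p. 4 and §4.1 (arXiv v5): "there are at least an order of `n^ν` locations to which `φ'` may be translated
and then attached to `φ`").  There the lattice is `ℤ²`; this file is the triangular-lattice edition of the lane's `ℤ²` file
`SAWPolygonJoinSpec.lean` (`JoinMapSpec`, `joinIneq2_of_spec`): it fixes the SHAPE of the join map as a `Prop` and proves the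
assembly, so that the LINE is closed modulo that one `Prop` (the cap table `SAWTriangularPolygonJoinCap.lean`, the sliding lemma
`SAWTriangularPolygonJoinSlide.lean`, the decoder `SAWTriangularPolygonJoinDecode.lean` and the tall-third lemma
`SAWTriangularPolygonTallThird.lean` are its ingredients; design note `HOME/pub-sawmu-a-p4/g10/DESIGN-tri-cap.md`: `K = 8`).

## Contents (namespace `Literature.Probability.RandomPlanarGeometry.SAW`)

* `JoinMapSpecTri c K N` — a finite domain of size `≥ c·√N·q_N²` mapped injectively into the canonical traversals
  `TriPolygon.triPolygonReps (2N + K − 1)` of the `(2N+K)`-gons;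
* `joinIneqTri_of_spec` — `JoinMapSpecTri c K N → c·√N·q_N² ≤ q_{2N+K}`;
* **`triPolygonNumber_le_rpow_of_joinMapSpec`** — if `JoinMapSpecTri c K N` holds for all `N ≥ N₀` (some `c > 0`), then
  `∃ A, ∀ N ≥ 1, q_N(𝕋) ≤ A·N^{−1/2}·μ(𝕋)^N` (Madras' bound on `𝕋`, `θ ≥ 1/2`).
-/

noncomputable section

open Finset Literature.Probability.LatticeModels Literature.Probability.Percolation

namespace Literature.Probability.RandomPlanarGeometry.SAW

/-- **The join-map specification at length `N`** (triangular lattice, brick frame): a finite domain `D` (tall left polygon ×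
any right polygon × admissible vertical offsets) of size at least `c·√N·q_N(𝕋)²`, mapped injectively into the canonical
traversals of the `(2N+K)`-gons.  [cite: Madras1995LatticeAnimalsExponent, §2 (the injective join at `Ω(n^{1/2})` heights);
Hammond2015SAPJoining, Definition 4.3 p. 20 (arXiv v5: the Madras join polygon)] -/
def JoinMapSpecTri (c : ℝ) (K N : ℕ) : Prop :=
  ∃ (ι : Type) (D : Finset ι) (Ψ : ι → (ℕ → Site 2)),
    c * Real.sqrt N * (triPolygonNumber N : ℝ) ^ 2 ≤ (D.card : ℝ) ∧
    (∀ x ∈ D, Ψ x ∈ TriPolygon.triPolygonReps (2 * N + K - 1)) ∧ Set.InjOn Ψ ↑D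

/-- **The join inequality from the specification**: `c·√N·q_N² ≤ q_{2N+K}` (count the domain through the injective map).
[cite: Madras1995LatticeAnimalsExponent, §2; Hammond2015SAPJoining, §3.4 eq. (3.6) pp. 12–13 (arXiv v5: Madras' counting)] -/
theorem joinIneqTri_of_spec {c : ℝ} {K N : ℕ} (h : JoinMapSpecTri c K N) :
    c * Real.sqrt N * (triPolygonNumber N : ℝ) ^ 2 ≤ triPolygonNumber (2 * N + K) := by
  classical
  obtain ⟨ι, D, Ψ, hD, hΨ, hinj⟩ := h
  have hcard : D.card ≤ (TriPolygon.triPolygonReps (2 * N + K - 1)).card := by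
    calc D.card = (D.image Ψ).card := (Finset.card_image_of_injOn hinj).symm
      _ ≤ (TriPolygon.triPolygonReps (2 * N + K - 1)).card :=
          Finset.card_le_card (fun y hy => by
            obtain ⟨x, hx, rfl⟩ := Finset.mem_image.1 hy
            exact hΨ x hx)
  have hq : (TriPolygon.triPolygonReps (2 * N + K - 1)).card = triPolygonNumber (2 * N + K) := by
    unfold triPolygonNumber; rfl
  calc c * Real.sqrt N * (triPolygonNumber N : ℝ) ^ 2 ≤ (D.card : ℝ) := hD
    _ ≤ ((TriPolygon.triPolygonReps (2 * N + K - 1)).card : ℝ) := by exact_mod_cast hcard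
    _ = (triPolygonNumber (2 * N + K) : ℝ) := by rw [hq]

/-- **Madras' bound on `𝕋` from the join-map specification**: if for some `c > 0`, `K` and all `N ≥ N₀` the join map of
length `N` exists (`JoinMapSpecTri c K N`), then `q_N(𝕋) ≤ A·N^{−1/2}·μ(𝕋)^N` for all `N ≥ 1` — the LINE «TRI-MADRAS» is
closed modulo `JoinMapSpecTri`.  [cite: Madras1995LatticeAnimalsExponent, §2 (θ ≥ 1/2 in two dimensions);
Hammond2015SAPJoining, §2 p. 4 (arXiv v5)] -/
theorem triPolygonNumber_le_rpow_of_joinMapSpec {c : ℝ} {K N₀ : ℕ} (hc : 0 < c)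
    (h : ∀ N : ℕ, N₀ ≤ N → JoinMapSpecTri c K N) :
    ∃ A : ℝ, ∀ N : ℕ, 1 ≤ N →
      (triPolygonNumber N : ℝ) ≤ A * (N : ℝ) ^ (-(1 / 2 : ℝ)) * Real.exp logMuTri ^ N := by
  refine triPolygonNumber_le_rpow_of_joinIneq (K := K) (N₀ := N₀) hc fun N hN => ?_
  exact joinIneqTri_of_spec (h N hN)

end Literature.Probability.RandomPlanarGeometry.SAW
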